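import Literature.NumberTheory.EllipticCurves.SupersingularDensitySerreTraceProofs
import Literature.NumberTheory.EllipticCurves.HasseWeilGoodReductionProofs
import Literature.NumberTheory.EllipticCurves.TorsionFrobeniusChebotarevProofs
import Literature.NumberTheory.EllipticCurves.LFunctionPrimeCoeff
import Literature.NumberTheory.EllipticCurves.OrdinaryPrimesProofs
import Literature.RepresentationTheory.FiniteGroups.InvariantLineOfFixedVectors
import Mathlib.LinearAlgebra.Matrix.Charpoly.Coeff
import Mathlib.LinearAlgebra.Charpoly.ToMatrix
import Mathlib.LinearAlgebra.Eigenspace.Charpoly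
import HarnessLib

/-!
# Irreducibility of `E[p]` passes along a mod-`p` congruence of Frobenius traces — proofs

Topic `NumberTheory/EllipticCurves` (trunk T-ELLARITH); a `Proofs` file (theorems only, nothing is
defined, no named fact) in the series `ModPReducibility` / `ModPReducibilityProofs` /
`ModPReducibilityAlmostAllProofs` on the mod-`p` Galois representation
`ρ̄_{E,p} : Γ_ℚ → Aut(E[p])` (`WeierstrassCurve.galoisRepTorsion`,
`WeierstrassCurve.HasIrreducibleModPGaloisRep`) and the traces of Frobenius `a_ℓ(E)`
(`WeierstrassCurve.frobeniusTrace`).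

Darmon–Diamond–Taylor, *Fermat's Last Theorem* (1995) [held copy
`paper:doi-10-4310-cdm-1995-v1995-n1-a1`, read 2026-08-22]: Thm. 2.3 (PDF p. 52 L6–L7:
"(Chebotarev) If `F/ℚ` is a Galois extension unramified outside a finite set `S` of primes then
`∪_{p ∉ S} [Frob_p]` is dense in `Gal(F/ℚ)`"), Prop. 2.6 (b) (PDF p. 53 L25–L33: "Let `S` be any
finite set of primes. … A semi-simple mod `ℓ` representation `ρ : G_ℚ → GL_d(k)` is determined by
the values of `tr ∧^i ρ(Frob_p)` (`i = 1, …, d`) on the primes `p ∉ S` at which `ρ` is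
unramified"), Prop. 2.8 (a) (PDF p. 56: "`det ρ_{E,ℓ} = ε`"), Prop. 2.11 (a) (PDF p. 57 L1–L5:
"Suppose `E` has good reduction at `p`. (a) If `ℓ ≠ p`, then `ρ_{E,ℓ}` is unramified at `p`, and
… `tr ρ_{E,ℓ}(Frob_p) = p + 1 − #Ē_p(𝔽_p)`").  Consequently, for two elliptic curves `W, G / ℚ`
with `a_ℓ(W) ≡ a_ℓ(G) (mod p)` at the good primes `ℓ` off a finite set, `ρ̄_{W,p}` and `ρ̄_{G,p}`
have the same semisimplification; in particular **`W[p]` is irreducible iff `G[p]` is** — the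
statement proved here (`hasIrreducibleModPGaloisRep_of_frobeniusTrace_congr_off_finite`,
`…_iff_…`), which is what the cell `b2b-bsdres` (O5 / X4 congruence nodes: "so `ρ̄_G ≅ ρ̄_W` by
Brauer–Nesbitt–Chebotarev") uses.

## The proof formalised (Chebotarev + the eigenvalue of a stable line; no Brauer–Nesbitt)

If `G[p]` has a `Γ_ℚ`-stable line `H = 𝔽_p h₀`, then `σ h₀ = ψ(σ) h₀` for a character
`ψ : Γ_ℚ → 𝔽_p^×`.  At an arithmetic Frobenius `φ` above a prime `ℓ ∉ S ∪ {p} ∪ {bad}` the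
`𝔽_p`-linear endomorphisms `ρ̄_W(φ)`, `ρ̄_G(φ)` of the two planes have the same trace
(`a_ℓ(W) ≡ a_ℓ(G)`; the tree's `trace_galoisRepTorsion_frobenius_eq`, Serre 1981 (238) /
DDT 2.11 (a)) and the same determinant (`ℓ`; §1, `det_galoisRepTorsion_frobenius_eq`, from the
tree's `det_galoisRepTate_frobenius_of_hasGoodReductionAt_holds`, DDT 2.8 (a)), hence the same
characteristic polynomial `X² − tr·X + det` (§3, Mathlib `Matrix.charpoly_fin_two`); `ψ(φ)` is an
eigenvalue of `ρ̄_G(φ)`, so of `ρ̄_W(φ)`.  By Chebotarev for `ℚ(W[p], G[p])` (§2,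
`exists_frobenius_smul_eq_pair`: the tree's PROVED `GaloisRepresentations.chebotarevArtinRep_holds`
applied to the permutation representation on `W[p] × G[p]`, as `exists_framedArtinRep_geomTorsion`
does for one curve) every `σ ∈ Γ_ℚ` acts on both modules as such a `φ`, so every `σ` has the
eigenvalue `ψ(σ)` on `W[p]`; the twisted representation `σ ↦ ψ(σ)⁻¹ ρ̄_W(σ)` then fixes a non-zero
vector for every `σ`, hence stabilises a line (the tree's
`Representation.exists_ne_bot_ne_top_invariant_of_forall_exists_fixed`,
`RepresentationTheory/FiniteGroups/InvariantLineOfFixedVectors`), which is a `Γ_ℚ`-stable line of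
`W[p]` — `W[p]` is reducible.

* §1 `WeierstrassCurve.det_galoisRepTorsion_eq_toZMod_det_galoisRepTate` (any field, `ℓ ≠ char`:
  `det(σ | E[ℓ]) = det(σ | T_ℓ E) mod ℓ`), `WeierstrassCurve.det_galoisRepTorsion_frobenius_eq`
  (`det ρ̄_{E,ℓ}(σ_p) = p mod ℓ` at a good `p ≠ ℓ`);
* §2 `exists_framedArtinRep_geomTorsion_prod` (private), `exists_frobenius_smul_eq_pair`;
* §3 (private plane linear algebra) `charpoly_eq_of_finrank_eq_two`,
  `exists_eigenvector_iff_of_finrank_eq_two`, `exists_eigenvector_of_trace_eq_of_det_eq`;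
* §4 `hasIrreducibleModPGaloisRep_of_frobeniusTrace_congr_off_finite`,
  `hasIrreducibleModPGaloisRep_iff_of_frobeniusTrace_congr_off_finite`.

## References

* H. Darmon, F. Diamond, R. Taylor, *Fermat's Last Theorem*, Current Developments in Mathematics
  1995, International Press, 1–154: Thm. 2.3, Prop. 2.6 (b), Prop. 2.8 (a), Prop. 2.11 (a)
  (PDF pp. 52–57). [DarmonDiamondTaylor1995]
* J.-P. Serre, *Quelques applications du théorème de densité de Chebotarev*, Publ. Math. IHÉS 54
  (1981), §8.1 (238). [Serre1981]
* J. Tate, *Global class field theory*, in Cassels–Fröhlich (1967), Ch. VII §2.4. [TateGCFT1967]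
* J. H. Silverman, *The Arithmetic of Elliptic Curves*, 2nd ed. (2009), III.§7, C.21 Remark 21.3.
  [SilvermanAEC2009]

## Design

Theorems only; no `def`, no named fact, no new vocabulary (the character `ψ` and the twisted
representation live inside the proof); axioms of every theorem: `propext`, `Classical.choice`,
`Quot.sound`.  Cell `b2b-bsdres`, harvest seat 2, GEN 52, E108.
-/

noncomputable section

open scoped Classical NumberField
open IsDedekindDomain Field Polynomial

universe u

namespace WeierstrassCurve

open Literature.NumberTheory.EllipticCurves Literature.NumberTheory.GaloisRepresentations

/-! ### §1 The determinant on `E[ℓ]` is the determinant on `T_ℓ E` reduced mod `ℓ` -/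

section AnyField

variable {K : Type u} [Field K] (W : WeierstrassCurve K) (ℓ : ℕ) [Fact ℓ.Prime]

/-- **The matrix of `σ` on `E[ℓ]` is the reduction mod `ℓ` of its matrix on `T_ℓ E`, hence so is
its determinant.**  For an elliptic curve `E` over a field `K`, a prime `ℓ ≠ char K` and
`σ ∈ Γ_K`, the determinant of `σ` acting `𝔽_ℓ`-linearly on `E[ℓ]` (`galoisRepTorsion`) is
`PadicInt.toZMod` of the determinant of `σ` on `T_ℓ E` (`galoisRepTate`): the images
`P₀, P₁ ∈ E[ℓ]` of a `ℤ_ℓ`-basis of `T_ℓ E` form an `𝔽_ℓ`-basis of `E[ℓ]` in which `σ` acts through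
the reduction of its `ℤ_ℓ`-matrix (Silverman, *AEC*, III.§7; the computation of
`trace_galoisRepTorsion_eq_toZMod_trace_galoisRepTate`, for all four entries).
[cite: SilvermanAEC2009, III.§7 (T_ℓ E and E[ℓ^n]) with Cor. III.6.4(b)] -/
theorem det_galoisRepTorsion_eq_toZMod_det_galoisRepTate [W.IsElliptic] (hℓ : (ℓ : K) ≠ 0)
    (σ : absoluteGaloisGroup K) :
    letI : Module (ZMod ℓ) (geomTorsion W ℓ) := AddSubgroup.torsionBy.zmodModule
    LinearMap.det ((galoisRepTorsion W ℓ σ).toAdd.toAddMonoidHom.toZModLinearMap ℓ) =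
      PadicInt.toZMod (LinearMap.det (W.galoisRepTate ℓ σ :
        W.tateModule ℓ →ₗ[ℤ_[ℓ]] W.tateModule ℓ)) := by
  letI : Module (ZMod ℓ) (geomTorsion W ℓ) := AddSubgroup.torsionBy.zmodModule
  have hp : ℓ.Prime := Fact.out
  haveI := module_free_tateModule_holds W ℓ
  haveI := module_finite_tateModule_holds W ℓ
  let b := Module.finBasisOfFinrankEq ℤ_[ℓ] (W.tateModule ℓ) (finrank_tateModule_eq_two_holds W ℓ hℓ)
  -- the images `P i ∈ E[ℓ]` of the basis vectors
  have hmem : ∀ i, TateModule.proj ℓ 1 (b i) ∈ geomTorsion W ℓ := fun i ↦ by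
    simpa only [pow_one] using proj_tateModule_mem_geomTorsion W ℓ 1 (b i)
  let P : Fin 2 → geomTorsion W ℓ := fun i ↦ ⟨TateModule.proj ℓ 1 (b i), hmem i⟩
  -- the `𝔽_ℓ`-linear map `(x₀, x₁) ↦ x₀ P₀ + x₁ P₁`
  let L : (Fin 2 → ZMod ℓ) →ₗ[ZMod ℓ] geomTorsion W ℓ := Fintype.linearCombination (ZMod ℓ) P
  have hL : ∀ c : Fin 2 → ZMod ℓ, L c = c 0 • P 0 + c 1 • P 1 := fun c ↦ by
    simp only [L, Fintype.linearCombination_apply, Fin.sum_univ_two]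
  have hLcoe : ∀ x y : ℤ_[ℓ], ((L ![PadicInt.toZMod x, PadicInt.toZMod y] : geomTorsion W ℓ) :
      geomPoints W) = (PadicInt.toZModPow 1 x).val • TateModule.proj ℓ 1 (b 0) +
        (PadicInt.toZModPow 1 y).val • TateModule.proj ℓ 1 (b 1) := fun x y ↦ by
    rw [hL]
    simp only [Matrix.cons_val_zero, Matrix.cons_val_one, Matrix.cons_val_fin_one]
    rw [toZMod_smul_geomTorsion_eq, toZMod_smul_geomTorsion_eq, AddSubgroup.coe_add,
      AddSubgroupClass.coe_nsmul, AddSubgroupClass.coe_nsmul]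
  -- `L` is onto: `T_ℓ E → E[ℓ]` is onto and `a ↦ a_1` is `Σ (b.repr a i mod ℓ) (b i)_1`
  have hLsurj : Function.Surjective L := fun S ↦ by
    have hS : (S : geomPoints W) ∈ geomTorsion W (ℓ ^ 1 : ℕ) := by
      simpa only [pow_one] using S.2
    obtain ⟨a, ha⟩ := proj_surjective_of_isAlgClosed_holds W ℓ 1 hS
    refine ⟨![PadicInt.toZMod (b.repr a 0), PadicInt.toZMod (b.repr a 1)], Subtype.ext ?_⟩
    rw [hLcoe, ← proj_eq_sum_repr W ℓ b a 1, ha]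
  -- hence bijective, `#E[ℓ] = ℓ² = #𝔽_ℓ²`
  have hℓ' : (ℓ : AlgebraicClosure K) ≠ 0 := fun h ↦ hℓ <|
    (algebraMap K (AlgebraicClosure K)).injective (by rw [map_natCast, map_zero, h])
  haveI : Finite (geomTorsion W ℓ) :=
    finite_torsionPoints_holds W (AlgebraicClosure K) (n := ℓ) (by exact_mod_cast hp.ne_zero)
  have hcardE : Nat.card (geomTorsion W ℓ) = ℓ ^ 2 :=
    card_torsionPoints_eq_sq_holds W (AlgebraicClosure K) (n := ℓ) hℓ'
  have hLbij : Function.Bijective L := by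
    rw [Nat.bijective_iff_surjective_and_card]
    refine ⟨hLsurj, ?_⟩
    rw [hcardE, Nat.card_fun, Nat.card_eq_fintype_card, ZMod.card, Nat.card_eq_fintype_card,
      Fintype.card_fin]
  let e : geomTorsion W ℓ ≃ₗ[ZMod ℓ] (Fin 2 → ZMod ℓ) := (LinearEquiv.ofBijective L hLbij).symm
  have he : ∀ c, e (L c) = c := fun c ↦ (LinearEquiv.ofBijective L hLbij).symm_apply_apply c
  let c : Module.Basis (Fin 2) (ZMod ℓ) (geomTorsion W ℓ) := Module.Basis.ofEquivFun e
  have hc : ∀ i, c i = P i := fun i ↦ by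
    rw [Module.Basis.coe_ofEquivFun]
    show e.symm (Pi.single i 1) = P i
    rw [LinearEquiv.symm_apply_eq, ← he (Pi.single i 1)]
    congr 1
    simp only [L, Fintype.linearCombination_apply_single, one_smul]
  -- the matrix of `σ` on `T_ℓ E` and the action on the `P i`
  set M := LinearMap.toMatrix b b (W.galoisRepTate ℓ σ) with hMdef
  set f := (galoisRepTorsion W ℓ σ).toAdd.toAddMonoidHom.toZModLinearMap ℓ with hfdef
  have hf : ∀ Q : geomTorsion W ℓ, f Q = σ • Q := fun Q ↦ rfl
  have hcol : ∀ j, σ • P j = L ![PadicInt.toZMod (M 0 j), PadicInt.toZMod (M 1 j)] := fun j ↦ by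
    refine Subtype.ext ?_
    rw [AddSubgroup.torsionBy.coe_smul, hLcoe]
    show σ • TateModule.proj ℓ 1 (b j) = _
    have h1 : σ • TateModule.proj ℓ 1 (b j) = TateModule.proj ℓ 1 (W.galoisRepTate ℓ σ (b j)) := by
      rw [galoisRepTate_apply_apply, TateModule.proj_smul_of_distribMulAction]
    rw [h1, proj_eq_sum_repr W ℓ b _ 1, hMdef, LinearMap.toMatrix_apply, LinearMap.toMatrix_apply]
  -- all four matrix entries in the bases `c` and `b`
  have hentry : ∀ i j, LinearMap.toMatrix c c f i j = PadicInt.toZMod (M i j) := fun i j ↦ by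
    rw [LinearMap.toMatrix_apply, hc, hf, hcol, Module.Basis.ofEquivFun_repr_apply, he]
    fin_cases i <;> rfl
  rw [← LinearMap.det_toMatrix c, ← LinearMap.det_toMatrix b, ← hMdef, Matrix.det_fin_two,
    Matrix.det_fin_two, map_sub, map_mul, map_mul, hentry, hentry, hentry, hentry]

end AnyField

section Rat

open NumberField Rat.HeightOneSpectrum

variable (W : WeierstrassCurve ℚ) [W.IsElliptic] [W.IsGloballyMinimal]

omit [W.IsGloballyMinimal] in
/-- **`det ρ̄_{E,ℓ}(σ_p) = p mod ℓ`** (Darmon–Diamond–Taylor 1995, Prop. 2.8 (a): `det ρ_{E,ℓ} = ε`,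
the cyclotomic character, with `ε(Frob_p) = p`; Silverman, *AEC*, C.21 Remark 21.3, "Norm
`ρ(φ_v) = q_v`").  Let `E = W/ℚ` be an elliptic curve, `ℓ` a prime, `p ≠ ℓ` a prime of good
reduction, `v` the place of `ℚ` at `p`, `𝔓` a prime of `\bar ℤ` above `v` and `σ ∈ Γ_ℚ` an
arithmetic Frobenius at `𝔓`.  Then the determinant of `σ` on the `𝔽_ℓ`-plane `E[ℓ]` is `p mod ℓ`:
the determinant on `E[ℓ]` is the determinant on `T_ℓ E` mod `ℓ`
(`det_galoisRepTorsion_eq_toZMod_det_galoisRepTate`), the latter is `q_v = p` (the tree's theorem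
`det_galoisRepTate_frobenius_of_hasGoodReductionAt_holds`).
[cite: DarmonDiamondTaylor1995, Prop. 2.8 (a) and Prop. 2.11 (a) (PDF pp. 56–57)]
[cite: SilvermanAEC2009, C.21 Remark 21.3] -/
theorem det_galoisRepTorsion_frobenius_eq (ℓ : ℕ) [Fact ℓ.Prime] {p : ℕ} [Fact p.Prime]
    (hpℓ : p ≠ ℓ) (hgood : W.HasGoodReductionAtPrime p) {v : HeightOneSpectrum (𝓞 ℚ)}
    (hv : (primesEquiv v : ℕ) = p) {𝔓 : Ideal (absIntegers (𝓞 ℚ) ℚ)} (h𝔓 : 𝔓 ∈ v.primesAbove)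
    {σ : absoluteGaloisGroup ℚ} (hσ : IsArithFrobAt (𝓞 ℚ) σ 𝔓) :
    letI : Module (ZMod ℓ) (geomTorsion W ℓ) := AddSubgroup.torsionBy.zmodModule
    LinearMap.det ((galoisRepTorsion W ℓ σ).toAdd.toAddMonoidHom.toZModLinearMap ℓ) =
      (p : ZMod ℓ) := by
  letI : Module (ZMod ℓ) (geomTorsion W ℓ) := AddSubgroup.torsionBy.zmodModule
  have hℓ : ℓ.Prime := Fact.out
  have hne : (primesEquiv v : ℕ) ≠ ℓ := hv ▸ hpℓ
  have hℓv : ((ℓ : ℕ) : 𝓞 ℚ) ∉ v.asIdeal := natCast_not_mem_asIdeal_of_primesEquiv_ne hℓ hne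
  have hgood' : W.HasGoodReductionAt v :=
    (hasGoodReductionAtPrime_primesEquiv_iff_holds W v p hv).mp hgood
  rw [det_galoisRepTorsion_eq_toZMod_det_galoisRepTate W ℓ (by exact_mod_cast hℓ.ne_zero) σ,
    W.det_galoisRepTate_frobenius_of_hasGoodReductionAt_holds ℓ v hℓv hgood' h𝔓 hσ,
    natCard_residueField_adicCompletionIntegers, hv, map_natCast]

end Rat

end WeierstrassCurve

namespace Literature.NumberTheory.EllipticCurves

open WeierstrassCurve NumberField

/-! ### §2 Chebotarev for the compositum `ℚ(E[n], E'[n])` -/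

/-- **The permutation Artin representation of `Γ_ℚ` on `E[n] × E'[n]`** (`n ≠ 0`): an Artin
representation `ρ : Γ_ℚ → GL_m(ℂ)` with open kernel, faithful on the joint action: `ρ x = ρ y`
forces `x • P = y • P` for all `P ∈ E[n]` and all `P ∈ E'[n]` (the permutation representation of
the finite `Γ_ℚ`-set `E[n] × E'[n]`, as in `exists_framedArtinRep_geomTorsion`; Serre 1972, §4:
`Γ_ℚ` acts on `E[n]` through the finite quotient `Gal(ℚ(E[n])/ℚ)`). [folklore] -/
private theorem exists_framedArtinRep_geomTorsion_prod (W W' : WeierstrassCurve ℚ) [W.IsElliptic]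
    [W'.IsElliptic] {n : ℤ} (hn : n ≠ 0) :
    ∃ (m : ℕ) (ρ : GaloisRepresentations.FramedArtinRep ℚ m),
      IsOpen (ρ.toMonoidHom.ker : Set (absoluteGaloisGroup ℚ)) ∧
        ∀ x y : absoluteGaloisGroup ℚ, ρ x = ρ y →
          (∀ P : W.geomTorsion n, x • P = y • P) ∧ ∀ P : W'.geomTorsion n, x • P = y • P := by
  classical
  -- the finite `Γ_ℚ`-set `X = E[n] × E'[n]`
  set X := W.geomTorsion n × W'.geomTorsion n with hX
  haveI : Finite (W.geomTorsion n) := finite_torsionPoints_holds W (AlgebraicClosure ℚ) hn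
  haveI : Finite (W'.geomTorsion n) := finite_torsionPoints_holds W' (AlgebraicClosure ℚ) hn
  haveI : Finite X := Finite.instProd
  set m : ℕ := Nat.card X
  let e : X ≃ Fin m := Finite.equivFin X
  let a : absoluteGaloisGroup ℚ →* Equiv.Perm X := MulAction.toPermHom _ X
  let π : absoluteGaloisGroup ℚ →* Equiv.Perm (Fin m) := e.permCongrHom.toMonoidHom.comp a
  let M : absoluteGaloisGroup ℚ →* Matrix (Fin m) (Fin m) ℂ :=
    (Matrix.permMatrixHom (n := Fin m) (R := ℂ)).comp π
  let ρ₀ : absoluteGaloisGroup ℚ →* GL (Fin m) ℂ := M.toHomUnits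
  -- its kernel contains the open subgroup `⋂_{P} Stab(P) ∩ ⋂_{P'} Stab(P')`
  let K : Subgroup (absoluteGaloisGroup ℚ) :=
    (⨅ P : W.geomTorsion n, MulAction.stabilizer _ (P : W.geomPoints)) ⊓
      ⨅ P : W'.geomTorsion n, MulAction.stabilizer _ (P : W'.geomPoints)
  have hKopen : IsOpen (K : Set (absoluteGaloisGroup ℚ)) := by
    have : (K : Set (absoluteGaloisGroup ℚ)) =
        (⋂ P : W.geomTorsion n,
          (MulAction.stabilizer (absoluteGaloisGroup ℚ) (P : W.geomPoints) : Set _)) ∩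
        ⋂ P : W'.geomTorsion n,
          (MulAction.stabilizer (absoluteGaloisGroup ℚ) (P : W'.geomPoints) : Set _) := by
      simp only [K, Subgroup.coe_inf, Subgroup.coe_iInf]
    rw [this]
    exact (isOpen_iInter_of_finite fun P : W.geomTorsion n ↦
        isOpen_stabilizer_point_holds W (P : W.geomPoints)).inter
      (isOpen_iInter_of_finite fun P : W'.geomTorsion n ↦
        isOpen_stabilizer_point_holds W' (P : W'.geomPoints))
  have hKa : ∀ k ∈ K, a k = 1 := by
    intro k hk
    ext Q
    · have hkP : k ∈ MulAction.stabilizer (absoluteGaloisGroup ℚ) (Q.1 : W.geomPoints) :=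
        (Subgroup.mem_iInf.mp (Subgroup.mem_inf.mp hk).1) Q.1
      rw [MulAction.mem_stabilizer_iff] at hkP
      change ((k • Q.1 : W.geomTorsion n) : W.geomPoints) = (Q.1 : W.geomPoints)
      exact hkP
    · have hkP : k ∈ MulAction.stabilizer (absoluteGaloisGroup ℚ) (Q.2 : W'.geomPoints) :=
        (Subgroup.mem_iInf.mp (Subgroup.mem_inf.mp hk).2) Q.2
      rw [MulAction.mem_stabilizer_iff] at hkP
      change ((k • Q.2 : W'.geomTorsion n) : W'.geomPoints) = (Q.2 : W'.geomPoints)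
      exact hkP
  have hKρ : ∀ k ∈ K, ρ₀ k = 1 := by
    intro k hk
    ext : 1
    change Matrix.permMatrixHom (e.permCongrHom (a k)) = (1 : Matrix (Fin m) (Fin m) ℂ)
    rw [hKa k hk, map_one, map_one]
  have hcont : Continuous ρ₀ := continuous_of_isOpen_subgroup_le_ker ρ₀ K hKopen hKρ
  let ρ : GaloisRepresentations.FramedArtinRep ℚ m := ⟨ρ₀, hcont⟩
  refine ⟨m, ρ, ?_, fun x y hρ ↦ ?_⟩
  · exact Subgroup.isOpen_mono (H₁ := K) (fun k hk ↦ MonoidHom.mem_ker.mpr (hKρ k hk)) hKopen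
  · have hM : M x = M y := by
      have := congr_arg (fun u : GL (Fin m) ℂ ↦ (u : Matrix (Fin m) (Fin m) ℂ)) hρ
      exact this
    have hπ : π x = π y := by
      have h1 : Equiv.Perm.permMatrix ℂ (π x)⁻¹ = Equiv.Perm.permMatrix ℂ (π y)⁻¹ := hM
      have h2 : ((π x)⁻¹).toPEquiv = ((π y)⁻¹).toPEquiv := PEquiv.toMatrix_injective h1
      have h3 : (π x)⁻¹ = (π y)⁻¹ := by
        refine Equiv.ext fun i ↦ ?_
        have hi := congr_arg (fun q : Fin m ≃. Fin m ↦ q i) h2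
        simpa [Equiv.toPEquiv_apply] using hi
      exact inv_injective h3
    have ha : a x = a y := e.permCongrHom.injective hπ
    refine ⟨fun P ↦ ?_, fun P' ↦ ?_⟩
    · obtain ⟨P'⟩ : Nonempty (W'.geomTorsion n) := ⟨0⟩
      have := Equiv.congr_fun ha (P, P')
      exact congr_arg Prod.fst this
    · obtain ⟨P⟩ : Nonempty (W.geomTorsion n) := ⟨0⟩
      have := Equiv.congr_fun ha (P, P')
      exact congr_arg Prod.snd this

/-- **Chebotarev for the compositum of two division fields**: for elliptic curves `E, E'/ℚ`,
`n ≠ 0`, a finite set `S` of rational primes and `σ ∈ Γ_ℚ`, there are a prime `ℓ ∉ S`, a place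
`v ∣ ℓ`, a prime `𝔓 ∣ v` of `\bar ℤ` and an arithmetic Frobenius `φ` at `𝔓` acting as `σ` on BOTH
`E[n]` and `E'[n]` (Chebotarev's density theorem — the tree's theorem
`GaloisRepresentations.chebotarevArtinRep_holds`, Tate *GCFT* §2.4 — applied to the permutation
representation on `E[n] × E'[n]`; Darmon–Diamond–Taylor 1995, Thm. 2.3).
[cite: DarmonDiamondTaylor1995, Thm. 2.3 (PDF p. 52)] [cite: TateGCFT1967, §2.4 (Tchebotarev density theorem)] -/
theorem exists_frobenius_smul_eq_pair (W W' : WeierstrassCurve ℚ) [W.IsElliptic] [W'.IsElliptic]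
    {n : ℤ} (hn : n ≠ 0) (S : Set ℕ) (hS : S.Finite) (σ : absoluteGaloisGroup ℚ) :
    ∃ (ℓ : ℕ) (v : HeightOneSpectrum (𝓞 ℚ)) (𝔓 : Ideal (GaloisRepresentations.absIntegers (𝓞 ℚ) ℚ))
      (φ : absoluteGaloisGroup ℚ),
      ℓ.Prime ∧ ℓ ∉ S ∧ (ℓ : 𝓞 ℚ) ∈ v.asIdeal ∧ 𝔓 ∈ v.primesAbove ∧ IsArithFrobAt (𝓞 ℚ) φ 𝔓 ∧
        (∀ P : W.geomTorsion n, φ • P = σ • P) ∧ ∀ P : W'.geomTorsion n, φ • P = σ • P := by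
  obtain ⟨m, ρ, -, hfaith⟩ := exists_framedArtinRep_geomTorsion_prod W W' hn
  obtain ⟨v, ⟨-, 𝔓, h𝔓, φ, hφ, hρ⟩, hvB⟩ :=
    (GaloisRepresentations.chebotarevArtinRep_holds ℚ m ρ σ).exists_notMem_finite
      (finite_setOf_place_over S hS)
  obtain ⟨ℓ, hℓ, hℓv⟩ := exists_prime_natCast_mem v
  have hℓS : ℓ ∉ S := fun hmem ↦ hvB (Set.mem_biUnion (x := ℓ) ⟨hmem, hℓ.ne_zero⟩ hℓv)
  exact ⟨ℓ, v, 𝔓, φ, hℓ, hℓS, hℓv, h𝔓, hφ, (hfaith φ σ hρ).1, (hfaith φ σ hρ).2⟩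

/-! ### §3 Linear algebra on a plane: eigenvalues are the roots of `X² − tr·X + det` -/

section Plane

variable {k : Type*} [Field k] {V : Type*} [AddCommGroup V] [Module k V] [FiniteDimensional k V]

/-- On a `2`-dimensional space the characteristic polynomial of an endomorphism `f` is
`X² − tr(f) X + det(f)` (Mathlib `Matrix.charpoly_fin_two` in a basis). [folklore] -/
private theorem charpoly_eq_of_finrank_eq_two (h2 : Module.finrank k V = 2) (f : Module.End k V) :
    f.charpoly = X ^ 2 - C (LinearMap.trace k V f) * X + C (LinearMap.det f) := by
  let b := Module.finBasisOfFinrankEq k V h2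
  rw [← LinearMap.charpoly_toMatrix f b, Matrix.charpoly_fin_two,
    ← LinearMap.trace_eq_matrix_trace k b f, LinearMap.det_toMatrix b f]

/-- On a plane, `c` is an eigenvalue of `f` (some `v ≠ 0` has `f v = c • v`) iff
`c² − tr(f) c + det(f) = 0`. [folklore] -/
private theorem exists_eigenvector_iff_of_finrank_eq_two (h2 : Module.finrank k V = 2) (f : Module.End k V)
    (c : k) : (∃ v : V, v ≠ 0 ∧ f v = c • v) ↔
      c ^ 2 - LinearMap.trace k V f * c + LinearMap.det f = 0 := by
  have h := Module.End.hasEigenvalue_iff_isRoot_charpoly f c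
  rw [charpoly_eq_of_finrank_eq_two h2] at h
  simp only [Polynomial.IsRoot.def, eval_add, eval_sub, eval_mul, eval_pow, eval_X, eval_C] at h
  rw [← h]
  constructor
  · rintro ⟨v, hv0, hv⟩
    exact Module.End.hasEigenvalue_of_hasEigenvector ⟨Module.End.mem_eigenspace_iff.mpr hv, hv0⟩
  · intro hc
    obtain ⟨v, hv⟩ := hc.exists_hasEigenvector
    exact ⟨v, hv.2, Module.End.mem_eigenspace_iff.mp hv.1⟩

/-- **Eigenvalue transfer between two plane endomorphisms with the same trace and determinant**:
if `f` on `V` and `g` on `V'` (both `2`-dimensional) have `tr f = tr g` and `det f = det g`, then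
every eigenvalue of `f` is an eigenvalue of `g`. [folklore] -/
private theorem exists_eigenvector_of_trace_eq_of_det_eq {V' : Type*} [AddCommGroup V'] [Module k V']
    [FiniteDimensional k V'] (h2 : Module.finrank k V = 2) (h2' : Module.finrank k V' = 2)
    (f : Module.End k V) (g : Module.End k V') (htr : LinearMap.trace k V f = LinearMap.trace k V' g)
    (hdet : LinearMap.det f = LinearMap.det g) {c : k} (hc : ∃ v : V, v ≠ 0 ∧ f v = c • v) :
    ∃ w : V', w ≠ 0 ∧ g w = c • w := by
  rw [exists_eigenvector_iff_of_finrank_eq_two h2] at hc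
  rw [exists_eigenvector_iff_of_finrank_eq_two h2', ← htr, ← hdet]
  exact hc

end Plane

/-! ### §4 Irreducibility of `E[p]` passes along a congruence of traces -/

section Main

variable (W G : WeierstrassCurve ℚ) [W.IsElliptic] [W.IsGloballyMinimal] [G.IsElliptic]
  [G.IsGloballyMinimal] (p : ℕ) [Fact p.Prime]

/-- **Irreducibility of the mod-`p` representation passes along a mod-`p` congruence of Frobenius
traces off a finite set** (Darmon–Diamond–Taylor 1995, Prop. 2.6 (b) with Prop. 2.8 (a) and
Prop. 2.11 (a): `ρ̄_W ≅ ρ̄_G^{ss}` when the Frobenius characteristic polynomials agree off `S`).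
Let `W, G / ℚ` be elliptic curves in global minimal form, `p` a prime, `S ⊆ ℕ` finite, with
`p ∣ a_ℓ(W) − a_ℓ(G)` at every prime `ℓ ∉ S` of good reduction for both.  If `W[p]` is an
irreducible `Γ_ℚ`-module then so is `G[p]`.  Proof (Chebotarev + the eigenvalue of a stable line;
no Brauer–Nesbitt): if `G[p]` has a `Γ_ℚ`-stable line, `Γ_ℚ` acts on it by a character `ψ`; at an
arithmetic Frobenius `φ` above a good `ℓ ∉ S ∪ {p}` the endomorphisms of `W[p]` and `G[p]` have
the same trace (`a_ℓ`, Prop. 2.11 (a)) and determinant (`ℓ`, Prop. 2.8 (a)), so `ψ(φ)`, an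
eigenvalue on `G[p]`, is an eigenvalue on `W[p]`; by Chebotarev for `ℚ(W[p], G[p])` every `σ` is
such a `φ` on both modules, so every `σ` has the eigenvalue `ψ(σ)` on `W[p]`, i.e. the twist
`ψ⁻¹ ⊗ W[p]` has a fixed vector for every `σ`, hence a stable line — a stable line of `W[p]`.
[cite: DarmonDiamondTaylor1995, Prop. 2.6 (b), Prop. 2.8 (a), Prop. 2.11 (a) (PDF pp. 53–57)] -/
theorem hasIrreducibleModPGaloisRep_of_frobeniusTrace_congr_off_finite
    (hirr : W.HasIrreducibleModPGaloisRep p) (S : Set ℕ) (hS : S.Finite)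
    (hcong : ∀ (ℓ : ℕ) [Fact ℓ.Prime], ℓ ∉ S → W.HasGoodReductionAtPrime ℓ →
      G.HasGoodReductionAtPrime ℓ → (p : ℤ) ∣ W.frobeniusTrace ℓ - G.frobeniusTrace ℓ) :
    G.HasIrreducibleModPGaloisRep p := by
  classical
  by_contra hred
  have hp : p.Prime := Fact.out
  -- §4a: a `Γ_ℚ`-stable proper non-trivial subgroup `H` of `G[p]`
  obtain ⟨H, hHstab, hHbot, hHtop⟩ : ∃ H : AddSubgroup (G.geomTorsion p),
      (∀ σ : absoluteGaloisGroup ℚ, ∀ P ∈ H, σ • P ∈ H) ∧ H ≠ ⊥ ∧ H ≠ ⊤ := by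
    unfold WeierstrassCurve.HasIrreducibleModPGaloisRep at hred
    push Not at hred
    obtain ⟨H, hH, hbot, htop⟩ := hred
    exact ⟨H, hH, hbot, htop⟩
  letI instG : Module (ZMod p) (G.geomTorsion p) := AddSubgroup.torsionBy.zmodModule
  letI instW : Module (ZMod p) (W.geomTorsion p) := AddSubgroup.torsionBy.zmodModule
  have hpQ : (p : AlgebraicClosure ℚ) ≠ 0 := by exact_mod_cast hp.ne_zero
  haveI : Finite (G.geomTorsion p) :=
    finite_torsionPoints_holds G (AlgebraicClosure ℚ) (n := p) (by exact_mod_cast hp.ne_zero)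
  haveI : Finite (W.geomTorsion p) :=
    finite_torsionPoints_holds W (AlgebraicClosure ℚ) (n := p) (by exact_mod_cast hp.ne_zero)
  have hcardG : Nat.card (G.geomTorsion p) = p ^ 2 :=
    card_torsionPoints_eq_sq_holds G (AlgebraicClosure ℚ) (n := p) hpQ
  have hcardW : Nat.card (W.geomTorsion p) = p ^ 2 :=
    card_torsionPoints_eq_sq_holds W (AlgebraicClosure ℚ) (n := p) hpQ
  have h2G : Module.finrank (ZMod p) (G.geomTorsion p) = 2 :=
    Literature.RepresentationTheory.FiniteGroups.Representation.finrank_eq_two_of_natCard_eq_sq hcardG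
  have h2W : Module.finrank (ZMod p) (W.geomTorsion p) = 2 :=
    Literature.RepresentationTheory.FiniteGroups.Representation.finrank_eq_two_of_natCard_eq_sq hcardW
  haveI : Module.Finite (ZMod p) (W.geomTorsion p) := Module.Finite.of_finite
  haveI : Module.Finite (ZMod p) (G.geomTorsion p) := Module.Finite.of_finite
  -- scalars commute with the Galois action (the action is additive, the scalars act through `ℕ`)
  have hcommG : ∀ (σ : absoluteGaloisGroup ℚ) (c : ZMod p) (x : G.geomTorsion p),
      σ • (c • x) = c • (σ • x) := fun σ c x ↦ by
    rw [← ZMod.natCast_zmod_val c, Nat.cast_smul_eq_nsmul, Nat.cast_smul_eq_nsmul]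
    exact map_nsmul (DistribSMul.toAddMonoidHom (G.geomTorsion p) σ) c.val x
  have hcommW : ∀ (σ : absoluteGaloisGroup ℚ) (c : ZMod p) (x : W.geomTorsion p),
      σ • (c • x) = c • (σ • x) := fun σ c x ↦ by
    rw [← ZMod.natCast_zmod_val c, Nat.cast_smul_eq_nsmul, Nat.cast_smul_eq_nsmul]
    exact map_nsmul (DistribSMul.toAddMonoidHom (W.geomTorsion p) σ) c.val x
  -- §4b: `H` is the line through some `h₀ ≠ 0`, and `Γ_ℚ` acts on it by a character `ψ`
  obtain ⟨h₀, hh₀H, hh₀⟩ : ∃ h₀ : G.geomTorsion p, h₀ ∈ H ∧ h₀ ≠ 0 := by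
    obtain ⟨⟨x, hx⟩, hx0⟩ := AddSubgroup.ne_bot_iff_exists_ne_zero.mp hHbot
    exact ⟨x, hx, fun h ↦ hx0 (Subtype.ext h)⟩
  have hph₀ : p • h₀ = 0 := AddSubgroup.torsionBy.nsmul h₀
  have hord : addOrderOf h₀ = p := addOrderOf_eq_prime hph₀ hh₀
  have hHcard : Nat.card H = p := by
    have hdvd : Nat.card H ∣ p ^ 2 := hcardG ▸ AddSubgroup.card_addSubgroup_dvd_card H
    obtain ⟨i, hi, hHi⟩ := (Nat.dvd_prime_pow hp).mp hdvd
    interval_cases i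
    · exact absurd (AddSubgroup.card_eq_one.mp (by rw [hHi, pow_zero])) hHbot
    · rw [hHi, pow_one]
    · exact absurd ((AddSubgroup.card_eq_iff_eq_top H).mp (by rw [hHi, hcardG])) hHtop
  have hHeq : AddSubgroup.zmultiples h₀ = H :=
    AddSubgroup.eq_of_le_of_card_ge (AddSubgroup.zmultiples_le_of_mem hh₀H)
      (by rw [hHcard, Nat.card_zmultiples, hord])
  have hline : ∀ σ : absoluteGaloisGroup ℚ, ∃ c : ZMod p, c • h₀ = σ • h₀ := fun σ ↦ by
    have hmem : σ • h₀ ∈ AddSubgroup.zmultiples h₀ := hHeq ▸ hHstab σ h₀ hh₀H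
    obtain ⟨k, hk⟩ := AddSubgroup.mem_zmultiples_iff.mp hmem
    exact ⟨(k : ZMod p), by rw [Int.cast_smul_eq_zsmul, hk]⟩
  choose ψ hψ using hline
  have hinj : Function.Injective fun c : ZMod p ↦ c • h₀ := smul_left_injective (ZMod p) hh₀
  have hψ0 : ∀ σ, ψ σ ≠ 0 := fun σ h0 ↦ by
    have h := hψ σ
    rw [h0, zero_smul] at h
    exact hh₀ ((smul_eq_zero_iff_eq σ).mp h.symm)
  have hψ1 : ψ 1 = 1 := hinj (by simp only [hψ 1, one_smul])
  have hψmul : ∀ σ τ, ψ (σ * τ) = ψ σ * ψ τ := fun σ τ ↦ hinj (by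
    simp only
    rw [hψ (σ * τ), mul_smul σ τ h₀, ← hψ τ, hcommG, ← hψ σ, smul_smul, mul_comm])
  -- agreement on `G[p]` forces equal values of `ψ`
  have hψeq : ∀ σ τ : absoluteGaloisGroup ℚ, σ • h₀ = τ • h₀ → ψ σ = ψ τ := fun σ τ h ↦
    hinj (by simp only [hψ σ, hψ τ, h])
  -- §4c: every `σ` has an eigenvector on `W[p]` with eigenvalue `ψ σ`
  have hΔW : minimalDiscriminantInt W ≠ 0 := minimalDiscriminantInt_ne_zero W
  have hΔG : minimalDiscriminantInt G ≠ 0 := minimalDiscriminantInt_ne_zero G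
  let S' : Set ℕ := S ∪ {ℓ | ℓ ≤ max p (max (minimalDiscriminantInt W).natAbs
    (minimalDiscriminantInt G).natAbs)}
  have hS' : S'.Finite := hS.union (Set.finite_le_nat _)
  have key : ∀ σ : absoluteGaloisGroup ℚ, ∃ v : W.geomTorsion p, v ≠ 0 ∧ σ • v = ψ σ • v := by
    intro σ
    obtain ⟨ℓ, v, 𝔓, φ, hℓ, hℓS', hℓv, h𝔓, hφ, hWφ, hGφ⟩ :=
      exists_frobenius_smul_eq_pair W G (n := p) (by exact_mod_cast hp.ne_zero) S' hS' σ
    haveI : Fact ℓ.Prime := ⟨hℓ⟩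
    have hℓS : ℓ ∉ S := fun h ↦ hℓS' (Or.inl h)
    have hℓgt : max p (max (minimalDiscriminantInt W).natAbs (minimalDiscriminantInt G).natAbs) < ℓ :=
      not_le.mp fun h ↦ hℓS' (Or.inr h)
    have hℓp : ℓ ≠ p := by
      have := le_max_left p (max (minimalDiscriminantInt W).natAbs (minimalDiscriminantInt G).natAbs)
      omega
    have hℓΔW : ¬ (ℓ : ℤ) ∣ minimalDiscriminantInt W := fun h ↦ by
      have h1 := Nat.le_of_dvd (Int.natAbs_pos.mpr hΔW) (Int.natCast_dvd.mp h)
      have h2 : (minimalDiscriminantInt W).natAbs ≤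
          max p (max (minimalDiscriminantInt W).natAbs (minimalDiscriminantInt G).natAbs) :=
        (le_max_left _ _).trans (le_max_right _ _)
      omega
    have hℓΔG : ¬ (ℓ : ℤ) ∣ minimalDiscriminantInt G := fun h ↦ by
      have h1 := Nat.le_of_dvd (Int.natAbs_pos.mpr hΔG) (Int.natCast_dvd.mp h)
      have h2 : (minimalDiscriminantInt G).natAbs ≤
          max p (max (minimalDiscriminantInt W).natAbs (minimalDiscriminantInt G).natAbs) :=
        (le_max_right _ _).trans (le_max_right _ _)
      omega
    have hgoodW : W.HasGoodReductionAtPrime ℓ := hasGoodReductionAtPrime_of_not_dvd W ℓ hℓΔW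
    have hgoodG : G.HasGoodReductionAtPrime ℓ := hasGoodReductionAtPrime_of_not_dvd G ℓ hℓΔG
    have hvℓ : (Rat.HeightOneSpectrum.primesEquiv v : ℕ) = ℓ := primesEquiv_eq_of_natCast_mem hℓ hℓv
    -- the two `𝔽_p`-linear Frobenius endomorphisms
    set fW := (galoisRepTorsion W p φ).toAdd.toAddMonoidHom.toZModLinearMap p with hfWdef
    set fG := (galoisRepTorsion G p φ).toAdd.toAddMonoidHom.toZModLinearMap p with hfGdef
    have hfW : ∀ Q : W.geomTorsion p, fW Q = φ • Q := fun Q ↦ rfl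
    have hfG : ∀ Q : G.geomTorsion p, fG Q = φ • Q := fun Q ↦ rfl
    -- equal traces (`a_ℓ(W) ≡ a_ℓ(G)`) and determinants (`ℓ`)
    have htrW := W.trace_galoisRepTorsion_frobenius_eq p hℓp hgoodW hvℓ h𝔓 hφ
    have htrG := G.trace_galoisRepTorsion_frobenius_eq p hℓp hgoodG hvℓ h𝔓 hφ
    have hdetW := W.det_galoisRepTorsion_frobenius_eq p hℓp hgoodW hvℓ h𝔓 hφ
    have hdetG := G.det_galoisRepTorsion_frobenius_eq p hℓp hgoodG hvℓ h𝔓 hφ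
    have hcongr : ((G.frobeniusTrace ℓ : ℤ) : ZMod p) = ((W.frobeniusTrace ℓ : ℤ) : ZMod p) :=
      (ZMod.intCast_eq_intCast_iff_dvd_sub _ _ p).mpr (hcong ℓ hℓS hgoodW hgoodG)
    have htr : LinearMap.trace (ZMod p) _ fG = LinearMap.trace (ZMod p) _ fW := by
      rw [hfGdef, hfWdef, htrW, htrG, hcongr]
    have hdet : LinearMap.det fG = LinearMap.det fW := by
      rw [hfGdef, hfWdef, hdetW, hdetG]
    -- `ψ φ` is an eigenvalue of `fG` (eigenvector `h₀`), hence of `fW`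
    have heig : ∃ x : G.geomTorsion p, x ≠ 0 ∧ fG x = ψ φ • x := ⟨h₀, hh₀, by rw [hfG, hψ φ]⟩
    obtain ⟨w, hw0, hw⟩ := exists_eigenvector_of_trace_eq_of_det_eq h2G h2W fG fW htr hdet heig
    refine ⟨w, hw0, ?_⟩
    rw [← hWφ w, hψeq σ φ (hGφ h₀).symm, ← hfW w, hw]
  -- §4d: the twisted representation `σ ↦ ψ(σ)⁻¹ ρ̄_W(σ)` fixes a non-zero vector for every `σ`
  let ρW : _root_.Representation (ZMod p) (absoluteGaloisGroup ℚ) (W.geomTorsion p) :=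
    { toFun := fun σ ↦ (DistribSMul.toAddMonoidHom (W.geomTorsion p) σ).toZModLinearMap p
      map_one' := by ext; simp
      map_mul' := fun σ τ ↦ by ext; simp [mul_smul] }
  have hρW : ∀ σ (x : W.geomTorsion p), ρW σ x = σ • x := fun σ x ↦ rfl
  let ρ' : _root_.Representation (ZMod p) (absoluteGaloisGroup ℚ) (W.geomTorsion p) :=
    { toFun := fun σ ↦ (ψ σ)⁻¹ • ρW σ
      map_one' := by rw [hψ1, inv_one, one_smul, map_one]
      map_mul' := fun σ τ ↦ by
        refine LinearMap.ext fun x ↦ ?_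
        rw [LinearMap.smul_apply, Module.End.mul_apply, LinearMap.smul_apply,
          LinearMap.smul_apply, hρW, hρW, hρW, hψmul, mul_inv, mul_smul σ τ x, hcommW]
        exact (smul_smul ((ψ σ)⁻¹) ((ψ τ)⁻¹) (σ • τ • x)).symm }
  have hρ' : ∀ σ (x : W.geomTorsion p), ρ' σ x = (ψ σ)⁻¹ • (σ • x) := fun σ x ↦ rfl
  have hfix : ∀ σ : absoluteGaloisGroup ℚ, ∃ v : W.geomTorsion p, v ≠ 0 ∧ ρ' σ v = v := fun σ ↦ by
    obtain ⟨v, hv0, hv⟩ := key σ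
    refine ⟨v, hv0, ?_⟩
    rw [hρ', hv, smul_smul, inv_mul_cancel₀ (hψ0 σ), one_smul]
  obtain ⟨L, hLbot, hLtop, hL⟩ :=
    Literature.RepresentationTheory.FiniteGroups.Representation.exists_ne_bot_ne_top_invariant_of_forall_exists_fixed
      ρ' h2W hfix
  -- the line `L` is `Γ_ℚ`-stable for the original action: `σ • x = ψ(σ) • ρ'(σ) x`
  have hLstab : ∀ σ : absoluteGaloisGroup ℚ, ∀ x ∈ L.toAddSubgroup, σ • x ∈ L.toAddSubgroup := by
    intro σ x hx
    have h1 : σ • x = ψ σ • ρ' σ x := by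
      rw [hρ', smul_smul, mul_inv_cancel₀ (hψ0 σ), one_smul]
    rw [Submodule.mem_toAddSubgroup] at hx ⊢
    rw [h1]
    exact L.smul_mem _ (hL σ x hx)
  rcases hirr L.toAddSubgroup hLstab with h | h
  · exact hLbot (by rw [← Submodule.toAddSubgroup_inj, h, Submodule.bot_toAddSubgroup])
  · exact hLtop (Submodule.toAddSubgroup_eq_top.mp h)

/-- Symmetric form: along a mod-`p` congruence of traces off a finite set, `W[p]` is irreducible
iff `G[p]` is. [cite: DarmonDiamondTaylor1995, Prop. 2.6 (b) (PDF p. 53)] -/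
theorem hasIrreducibleModPGaloisRep_iff_of_frobeniusTrace_congr_off_finite (S : Set ℕ)
    (hS : S.Finite)
    (hcong : ∀ (ℓ : ℕ) [Fact ℓ.Prime], ℓ ∉ S → W.HasGoodReductionAtPrime ℓ →
      G.HasGoodReductionAtPrime ℓ → (p : ℤ) ∣ W.frobeniusTrace ℓ - G.frobeniusTrace ℓ) :
    W.HasIrreducibleModPGaloisRep p ↔ G.HasIrreducibleModPGaloisRep p :=
  ⟨fun h ↦ hasIrreducibleModPGaloisRep_of_frobeniusTrace_congr_off_finite W G p h S hS hcong,
    fun h ↦ hasIrreducibleModPGaloisRep_of_frobeniusTrace_congr_off_finite G W p h S hS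
      fun ℓ _ hℓS hgG hgW ↦ by
        have h1 := hcong ℓ hℓS hgW hgG
        rwa [← dvd_neg, neg_sub] at h1⟩

end Main

end Literature.NumberTheory.EllipticCurves

end
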